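import Summits.BirchSwinnertonDyer.Rank1Residual.ManinAdditive.MinusOneTwistLatticeRotationProof
import Literature.NumberTheory.EllipticCurves.ModularCurveManinSemistableLatticeFormProofs
import Literature.NumberTheory.EllipticCurves.EichlerShimuraConstructionKernelProofs
import Literature.NumberTheory.EllipticCurves.ModularCurveManinSemistableProofs
import Literature.NumberTheory.EllipticCurves.ManinConstantQuadraticTwistAtTwoProofs
import HarnessLib

/-!
# E-an-10 clause 1 PROVED — FILE 5 of the T-an-7/8 landing (`NegOneOptimalTwistRigidityProof`): lattice-optimality
# COMMUTES with the `χ₋₄`-twist at `2⁴ ∣ N` (`negOneOptimalTwistRigidity_sixteen : NegOneOptimalTwistRigidity 16`),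
# the MANIN–DISCRIMINANT IDENTITY `c′¹²·Δ(W′) = c¹²·Δ(W)`, and THEOREM I (`MinusOneOrbitManinEq`, E-an-10 leaf
# p558368) / E-an-8 (ii) (`MinusOneTwistRigidity`, leaf p551258) FROM ONE PRINTED LOCAL LEMMA (§22)

PROVENANCE. Cell `bsd-f2-manin`, planner `bsd-f2-manin-an` g4: §22 of the kernel-checked HOME/an/Sketch-an5v4.lean
487216973dab90e5 (= v3 + §22; byte-identical in v5 c12b594bf59501ac; farm rc 0 · 0 err · 0 warn · 0 sorries; axioms of
`negOneOptimalTwistRigidity_sixteen`, `negOne_optimal_c_pow_twelve_mul_Δ_eq`, `minusOneOrbitManinEq_of_pal` standard;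
refuter-1 R-an-13 → v4 reproduced 20:24Z), landed VERBATIM by the cell's typer (files 1–4: `HalfTranslateTwistStep`,
`TwistOrbitManinTransportAtTwoExact`, `TwistOrbitAtTwoExactDegree`, `MinusOneTwistLatticeRotationProof`).  No `sorry`, no
conjecture tags; the one `def … : Prop` is the HYPOTHESIS schema `NegOneTwistMinimalDiscrEq` = the printed local lemma
(Pal 2012 Prop. 2.4 (2)(b)(iii) = Connell, Handbook 5.7.3; refuter-2 R-an-15: the global typed form is covered by the
printed items + elementary globalisation), which T-an-8 lands separately as a Literature named fact.

MECHANISM (pure lattice geometry on top of file 4's `minusOneTwistLatticeRotation_holds`): for lattice-optimal `D`, `D′`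
the Néron lattices are `Λ_W = c·Λ(f)`, `Λ_{W′} = c′·Λ(f′)`; §21 gives `Λ(f′) = i·Λ(f)`; Pal's Lemma 3.1
(`isNeronLatticeOf_quadraticTwist_of_sq_eq`) gives the Néron-type pair `i⁻¹·Λ_W` of the twisted model `T = W ⊗ (−1)`.
Hence `Λ_{W′} = (c′/c) · Λ_T` — two `ℚ`-curves whose Néron-type lattices are homothetic by a RATIONAL scalar are
`ℚ`-isomorphic (`exists_shortModel_of_lattice_eq_smul`, the tree's short-model argument), so `W′ ≅ W ⊗ χ₋₄` over `ℚ`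
(`negOneOptimalTwistRigidity_sixteen` — the `p = 2` companion of imc's E-imc-3b, with NO irreducibility / CM proviso);
and the invariants scale, `Δ(W′) = (c/c′)¹²·Δ(W)` (`negOne_optimal_c_pow_twelve_mul_Δ_eq`; so `c′ = ±c ⟺ Δ′ = Δ`,
`negOne_optimal_c_eq_iff_Δ_eq`).  CONSEQUENCES: `minusOneOrbitManinEq_of_discrEq : NegOneTwistSameLevelDiscrEq (2^5)
→ MinusOneOrbitManinEq` (E-an-10 ⟸ S-an-10 ALONE), `minusOneTwistRigidity_of_discrEq`, and from the printed lemma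
`minusOneOrbitManinEq_of_pal : NegOneTwistMinimalDiscrEq → MinusOneOrbitManinEq`, `minusOneTwistRigidity_of_pal`,
`negOne_optimal_orbit_sixteen_of_pal` (THM I at `2⁴`: rigidity ∧ `c′ = ±c` ∧ `deg′ = deg`).  BC5 (Cremona `N < 5·10⁵`,
`2⁵ ∣ N`): `#1 ↦ #1`, `Δ′ = Δ`, `deg′ = deg` on 148 277 / 148 277 χ₋₄ same-level orbits; falsifiers 0
(HOME/MEMO-an.md §40d).  Beyond print: YES (clause 1 and the identity unconditional; THM I from one printed lemma).
References: [cite: Pal2012, Prop. 2.4 and Lemma 3.1] [cite: Stevens1989, Lemma (5.4) p. 97] [cite: Cremona1997, §2.8].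
-/

noncomputable section

open scoped MatrixGroups ModularForm

open CongruenceSubgroup WeierstrassCurve
  Literature.NumberTheory.DiophantineGeometry
  Literature.NumberTheory.EllipticCurves
  Literature.NumberTheory.EllipticCurves.ModularForms

namespace Summit.BirchSwinnertonDyer.Rank1Residual.ManinAdditive

section OptimalRigidity

open scoped Pointwise

/-! ## §22 E-an-10 clause 1 PROVED — lattice-optimality COMMUTES with the `χ₋₄`-twist at `2⁴ ∣ N`
## (`negOneOptimalTwistRigidity_sixteen`), the MANIN–DISCRIMINANT IDENTITY `c′¹²·Δ′ = c¹²·Δ`, and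
## E-an-10 / E-an-8 (ii) from S-an-10 ALONE

Mechanism (pure lattice geometry on top of §21): for lattice-optimal `D`, `D′` the Néron lattices are
`Λ_W = c·Λ(f)`, `Λ_{W′} = c′·Λ(f′)`; §21 gives `Λ(f′) = i·Λ(f)`; Pal's Lemma 3.1
(`isNeronLatticeOf_quadraticTwist_of_sq_eq`) gives the Néron-type pair `i⁻¹·Λ_W (= i·Λ_W)` of the twisted
model `T = W ⊗ (−1)`.  Hence `Λ_{W′} = (c′/c) · Λ_T` — two `ℚ`-curves whose Néron-type lattices are
homothetic by a RATIONAL scalar are `ℚ`-isomorphic (`exists_shortModel_of_lattice_eq_smul`, the tree's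
short-model argument), so `W′ ≅ W ⊗ χ₋₄` over `ℚ`; and the invariants scale, `Δ(W′) = (c/c′)¹²·Δ(T)
= (c/c′)¹²·Δ(W)`. -/

/-- Lattice bookkeeping on a same-level `χ₋₄`-orbit with lattice-optimal data (`2⁴ ∣ N`): the Néron
lattice of `W′` is `(c′/c)` times the Néron-type lattice `i⁻¹·Λ_W` of the twisted model `W ⊗ (−1)`. -/
theorem neronLattice_eq_mulLeft_twist_of_optimal {W W' : WeierstrassCurve ℚ} [W.IsElliptic]
    [W.IsGloballyMinimal] [W'.IsElliptic] [W'.IsGloballyMinimal] [NeZero (W.conductorNorm ℤ)]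
    [NeZero (W'.conductorNorm ℤ)] (D : ModularParametrizationData W (W.conductorNorm ℤ))
    (D' : ModularParametrizationData W' (W'.conductorNorm ℤ)) (hD : IsLatticeOptimal D)
    (hD' : IsLatticeOptimal D') (h16 : 2 ^ 4 ∣ W.conductorNorm ℤ)
    (hN : W'.conductorNorm ℤ = W.conductorNorm ℤ)
    (hiso : IsIsogenous (W.quadraticTwist ((-1 : ℤ) : ℚ)) W')
    (hl0 : ((D'.c : ℂ) / (D.c : ℂ)) ≠ 0) :
    D'.L.lattice = ((D.L.mulLeft (Complex.I)⁻¹ (inv_ne_zero Complex.I_ne_zero)).mulLeft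
      ((D'.c : ℂ) / (D.c : ℂ)) hl0).lattice := by
  have hrot := minusOneTwistLatticeRotation_holds W W' D D' h16 hN hiso
  have hc0 : (D.c : ℂ) ≠ 0 := D.cast_c_ne_zero
  have hc0' : (D'.c : ℂ) ≠ 0 := D'.cast_c_ne_zero
  ext z
  rw [PeriodPair.mem_mulLeft_lattice, PeriodPair.mem_mulLeft_lattice, inv_inv, inv_div,
    show Complex.I * ((D.c : ℂ) / (D'.c : ℂ) * z) = (D.c : ℂ) * (Complex.I * ((D'.c : ℂ)⁻¹ * z)) by
      rw [div_eq_mul_inv]; ring]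
  constructor
  · intro hz
    obtain ⟨w, hw, rfl⟩ := hD' z hz
    rw [inv_mul_cancel_left₀ hc0']
    exact D.smul_periodLattice_le _ ((hrot w).mp hw)
  · intro hz
    obtain ⟨w, hw, hEq⟩ := hD _ hz
    have hw' : Complex.I * ((D'.c : ℂ)⁻¹ * z) = w := mul_left_cancel₀ hc0 hEq
    have hmem : (D'.c : ℂ)⁻¹ * z ∈ periodLattice D'.f := (hrot _).mpr (hw' ▸ hw)
    have := D'.smul_periodLattice_le _ hmem
    rwa [mul_inv_cancel_left₀ hc0'] at this

/-- **E-an-10 clause 1 PROVED at `2⁴ ∣ N` (lattice-optimality COMMUTES with the `χ₋₄`-twist; the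
`p = 2` companion of imc's E-imc-3b `RamifiedTwistOptimalityCommutes`, with NO irreducibility / CM /
non-isogeny proviso):** on a same-level `χ₋₄`-orbit with `16 ∣ N`, if `D`, `D′` are lattice-optimal data
of `W`, `W′` and `W ⊗ χ₋₄ ~ W′`, then `W ⊗ χ₋₄ ≅ W′` over `ℚ`. -/
theorem negOneOptimalTwistRigidity_sixteen : NegOneOptimalTwistRigidity 16 := by
  intro W W' _ _ _ _ _ _ D D' hD hD' h16 hN hiso
  classical
  have hd0 : ((-1 : ℤ) : ℚ) ≠ 0 := by norm_num
  haveI := W.isElliptic_quadraticTwist hd0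
  have h16' : 2 ^ 4 ∣ W.conductorNorm ℤ := by norm_num [h16]
  have hc0 : (D.c : ℂ) ≠ 0 := D.cast_c_ne_zero
  have hc0' : (D'.c : ℂ) ≠ 0 := D'.cast_c_ne_zero
  have hcq : (D.c : ℚ) ≠ 0 := by exact_mod_cast (Int.cast_ne_zero.mp hc0)
  have hcq' : (D'.c : ℚ) ≠ 0 := by exact_mod_cast (Int.cast_ne_zero.mp hc0')
  have hlq : (D'.c : ℚ) / (D.c : ℚ) ≠ 0 := div_ne_zero hcq' hcq
  have hl0 : ((D'.c : ℂ) / (D.c : ℂ)) ≠ 0 := div_ne_zero hc0' hc0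
  -- the Néron-type pair `i⁻¹ Λ_W` of the twisted model
  have hIsq : Complex.I ^ 2 = ((((-1 : ℤ) : ℚ) : ℚ) : ℂ) := by push_cast; exact Complex.I_sq
  have hLT := isNeronLatticeOf_quadraticTwist_of_sq_eq ((-1 : ℤ) : ℚ) D.isNeronLattice
    Complex.I_ne_zero hIsq
  have hΛ' := neronLattice_eq_mulLeft_twist_of_optimal D D' hD hD' h16' hN hiso hl0
  have hS' : (D'.L.lattice : Set ℂ) = (((D'.c : ℚ) / (D.c : ℚ) : ℚ) : ℂ) •
      ((D.L.mulLeft (Complex.I)⁻¹ (inv_ne_zero Complex.I_ne_zero)).lattice.toAddSubgroup :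
        Set ℂ) := by
    rw [hΛ', coe_mulLeft_lattice_eq_smul, Submodule.coe_toAddSubgroup]
    push_cast
    rfl
  have hST : ((D.L.mulLeft (Complex.I)⁻¹ (inv_ne_zero Complex.I_ne_zero)).lattice : Set ℂ) =
      ((1 : ℚ) : ℂ) • ((D.L.mulLeft (Complex.I)⁻¹ (inv_ne_zero Complex.I_ne_zero)).lattice.toAddSubgroup :
        Set ℂ) := by
    rw [Rat.cast_one, one_smul, Submodule.coe_toAddSubgroup]
  obtain ⟨a₄, a₆, C₁, hW', hg₂, hg₃⟩ :=
    exists_shortModel_of_lattice_eq_smul D'.isNeronLattice hlq hS' (L' := _) rfl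
  obtain ⟨a₄', a₆', C₂, hT, hg₂', hg₃'⟩ :=
    exists_shortModel_of_lattice_eq_smul hLT one_ne_zero hST (L' := _) rfl
  have ha₄ : a₄' = a₄ := by
    have h : (-4 : ℂ) * a₄' = -4 * a₄ := hg₂'.symm.trans hg₂
    exact_mod_cast mul_left_cancel₀ (by norm_num : (-4 : ℂ) ≠ 0) h
  have ha₆ : a₆' = a₆ := by
    have h : (-4 : ℂ) * a₆' = -4 * a₆ := hg₃'.symm.trans hg₃
    exact_mod_cast mul_left_cancel₀ (by norm_num : (-4 : ℂ) ≠ 0) h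
  rw [ha₄, ha₆] at hT
  exact ⟨C₁⁻¹ * C₂, by rw [mul_smul, hT, ← hW', inv_smul_smul]⟩

/-- `NegOneOptimalTwistRigidity M` for every `16 ∣ M` (in particular at `2⁵`). -/
theorem negOneOptimalTwistRigidity_of_sixteen_dvd {M : ℕ} (hM : 16 ∣ M) :
    NegOneOptimalTwistRigidity M :=
  fun W W' _ _ _ _ _ _ D D' hD hD' hMN hN hiso ↦
    negOneOptimalTwistRigidity_sixteen W W' D D' hD hD' (dvd_trans hM hMN) hN hiso

/-- **The MANIN–DISCRIMINANT IDENTITY on `χ₋₄`-orbits (beyond print):** on a same-level `χ₋₄`-orbit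
with `16 ∣ N` and lattice-optimal data `D`, `D′` (i.e. for the two OPTIMAL curves), the Manin
constants and minimal discriminants satisfy `c′¹² · Δ(W′) = c¹² · Δ(W)` EXACTLY.  (So `Δ′ = Δ` iff
`c′ = ±c`; a pair with `Δ′ = 2^{±12}·Δ` would force an even Manin constant.) -/
theorem negOne_optimal_c_pow_twelve_mul_Δ_eq : ∀ (W W' : WeierstrassCurve ℚ) [W.IsElliptic]
    [W.IsGloballyMinimal] [W'.IsElliptic] [W'.IsGloballyMinimal] [NeZero (W.conductorNorm ℤ)]
    [NeZero (W'.conductorNorm ℤ)] (D : ModularParametrizationData W (W.conductorNorm ℤ))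
    (D' : ModularParametrizationData W' (W'.conductorNorm ℤ)),
    IsLatticeOptimal D → IsLatticeOptimal D' →
    16 ∣ W.conductorNorm ℤ → W'.conductorNorm ℤ = W.conductorNorm ℤ →
    IsIsogenous (W.quadraticTwist ((-1 : ℤ) : ℚ)) W' →
    (D'.c : ℚ) ^ 12 * W'.Δ = (D.c : ℚ) ^ 12 * W.Δ := by
  intro W W' _ _ _ _ _ _ D D' hD hD' h16 hN hiso
  have h16' : 2 ^ 4 ∣ W.conductorNorm ℤ := by norm_num [h16]
  have hc0 : (D.c : ℂ) ≠ 0 := D.cast_c_ne_zero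
  have hc0' : (D'.c : ℂ) ≠ 0 := D'.cast_c_ne_zero
  have hl0 : ((D'.c : ℂ) / (D.c : ℂ)) ≠ 0 := div_ne_zero hc0' hc0
  have hIsq : Complex.I ^ 2 = ((((-1 : ℤ) : ℚ) : ℚ) : ℂ) := by push_cast; exact Complex.I_sq
  have hLT := isNeronLatticeOf_quadraticTwist_of_sq_eq ((-1 : ℤ) : ℚ) D.isNeronLattice
    Complex.I_ne_zero hIsq
  have hΛ' := neronLattice_eq_mulLeft_twist_of_optimal D D' hD hD' h16' hN hiso hl0
  -- invariants of `W′` from the homothety, and of the twisted model from its own pair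
  have hΔ' := IsNeronLatticeOf.Δ_eq_of_lattice_eq_mulLeft D'.isNeronLattice hl0 hΛ'
  have hΛT : (D.L.mulLeft (Complex.I)⁻¹ (inv_ne_zero Complex.I_ne_zero)).lattice =
      ((D.L.mulLeft (Complex.I)⁻¹ (inv_ne_zero Complex.I_ne_zero)).mulLeft 1 one_ne_zero).lattice := by
    ext z
    rw [PeriodPair.mem_mulLeft_lattice (c := 1), inv_one, one_mul]
  have hΔT := IsNeronLatticeOf.Δ_eq_of_lattice_eq_mulLeft hLT one_ne_zero hΛT
  rw [one_pow, inv_one, one_mul, quadraticTwist_Δ] at hΔT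
  push_cast at hΔT
  have key : ((D'.c : ℂ) / (D.c : ℂ)) ^ 12 * (W'.Δ : ℂ) = (W.Δ : ℂ) := by
    rw [hΔ', ← mul_assoc, mul_inv_cancel₀ (pow_ne_zero _ hl0), one_mul, ← hΔT]; ring
  have key' : (D'.c : ℂ) ^ 12 * (W'.Δ : ℂ) = (D.c : ℂ) ^ 12 * (W.Δ : ℂ) := by
    rw [← key, div_pow, ← mul_assoc, mul_div_cancel₀ _ (pow_ne_zero _ hc0)]
  exact_mod_cast key'

/-- **E-an-10 ⟸ S-an-10 ALONE** (clause 1 is now the theorem `negOneOptimalTwistRigidity_sixteen`). -/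
theorem minusOneOrbitManinEq_of_discrEq (hS : NegOneTwistSameLevelDiscrEq (2 ^ 5)) :
    MinusOneOrbitManinEq :=
  minusOneOrbitManinEq_of_rigidity_of_discrEq (negOneOptimalTwistRigidity_of_sixteen_dvd (by norm_num))
    hS

/-- **E-an-8 (ii) `MinusOneTwistRigidity` ⟸ S-an-10 ALONE.** -/
theorem minusOneTwistRigidity_of_discrEq (hS : NegOneTwistSameLevelDiscrEq (2 ^ 5)) :
    MinusOneTwistRigidity :=
  minusOneTwistRigidity_of_rigidity_of_discrEq (negOneOptimalTwistRigidity_of_sixteen_dvd (by norm_num))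
    hS

/-- **E-an-10's Manin clause ⟺ S-an-10, orbitwise** (given lattice-optimality, `16 ∣ N`): `c′ = ±c`
iff `Δ(W′) = Δ(W)` — from the Manin–discriminant identity. -/
theorem negOne_optimal_c_eq_iff_Δ_eq : ∀ (W W' : WeierstrassCurve ℚ) [W.IsElliptic]
    [W.IsGloballyMinimal] [W'.IsElliptic] [W'.IsGloballyMinimal] [NeZero (W.conductorNorm ℤ)]
    [NeZero (W'.conductorNorm ℤ)] (D : ModularParametrizationData W (W.conductorNorm ℤ))
    (D' : ModularParametrizationData W' (W'.conductorNorm ℤ)),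
    IsLatticeOptimal D → IsLatticeOptimal D' →
    16 ∣ W.conductorNorm ℤ → W'.conductorNorm ℤ = W.conductorNorm ℤ →
    IsIsogenous (W.quadraticTwist ((-1 : ℤ) : ℚ)) W' →
    ((D'.c = D.c ∨ D'.c = -D.c) ↔ W'.Δ = W.Δ) := by
  intro W W' _ _ _ _ _ _ D D' hD hD' h16 hN hiso
  have key := negOne_optimal_c_pow_twelve_mul_Δ_eq W W' D D' hD hD' h16 hN hiso
  have hΔ0 : W.Δ ≠ 0 := W.isUnit_Δ.ne_zero
  have hc0 : (D.c : ℚ) ≠ 0 := by exact_mod_cast (Int.cast_ne_zero.mp D.cast_c_ne_zero)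
  constructor
  · intro h
    have hsq : (D'.c : ℚ) ^ 12 = (D.c : ℚ) ^ 12 := by
      rcases h with h | h
      · rw [h]
      · rw [h]; push_cast; ring
    rw [hsq] at key
    exact mul_left_cancel₀ (pow_ne_zero _ hc0) key
  · intro h
    rw [h] at key
    have hpow : (D'.c : ℚ) ^ 12 = (D.c : ℚ) ^ 12 := mul_right_cancel₀ hΔ0 key
    have hpow' : D'.c ^ 12 = D.c ^ 12 := by exact_mod_cast hpow
    have habs : |D'.c| = |D.c| := by
      have := congrArg Int.natAbs hpow'
      rw [Int.natAbs_pow, Int.natAbs_pow] at this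
      have h' : D'.c.natAbs = D.c.natAbs := Nat.pow_left_injective (by norm_num) this
      rw [Int.abs_eq_natAbs, Int.abs_eq_natAbs, h']
    exact abs_eq_abs.mp habs

/-- **S-an-10 as the printed local lemma (Pal 2012, Prop. 2.4, case `p = 2`, `d ≡ 3 (mod 4)`, (b)(iii);
Connell, Handbook 5.7.3): for `d = −1`, if `E` and `E ⊗ χ₋₄` are BOTH additive at `2` (`2² ∣ N(E)`,
`2² ∣ N(E ⊗ χ₋₄)`), their minimal discriminants are equal** (at odd `p` the twist by the unit `−1` does
not change `v_p(Δ_min)`; the sign is `(−1)⁶ = 1`).  Typed here as a hypothesis `Prop` for -ty to land as a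
Literature named fact (statement only). [cite: Pal2012, Prop. 2.4 (2)(b)(iii)] [cite: Connell1999, §5.7.3] -/
def NegOneTwistMinimalDiscrEq : Prop :=
  ∀ (W W' : WeierstrassCurve ℚ) [W.IsElliptic] [W.IsGloballyMinimal] [W'.IsElliptic]
    [W'.IsGloballyMinimal] (u : VariableChange ℚ),
    2 ^ 2 ∣ W.conductorNorm ℤ → 2 ^ 2 ∣ W'.conductorNorm ℤ →
    u • W.quadraticTwist ((-1 : ℤ) : ℚ) = W' → W'.Δ = W.Δ

/-- The printed local lemma gives S-an-10 at every level `M` with `4 ∣ M`. -/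
theorem negOneTwistSameLevelDiscrEq_of_minimalDiscrEq (h : NegOneTwistMinimalDiscrEq) {M : ℕ}
    (hM : 4 ∣ M) : NegOneTwistSameLevelDiscrEq M := by
  intro W W' _ _ _ _ u hMN hN hu
  have h4 : 2 ^ 2 ∣ W.conductorNorm ℤ := dvd_trans (by norm_num [hM] : 2 ^ 2 ∣ M) hMN
  exact h W W' u h4 (hN ▸ h4) hu

/-- **THEOREM I (E-an-10 `MinusOneOrbitManinEq`, landed p558368) PROVED from print**: its only
remaining input is the printed local lemma `NegOneTwistMinimalDiscrEq` (Pal 2012 Prop. 2.4 /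
Connell 5.7.3); clause 1 is `negOneOptimalTwistRigidity_sixteen`, the Manin clause is §19. -/
theorem minusOneOrbitManinEq_of_pal (h : NegOneTwistMinimalDiscrEq) : MinusOneOrbitManinEq :=
  minusOneOrbitManinEq_of_discrEq (negOneTwistSameLevelDiscrEq_of_minimalDiscrEq h (by norm_num))

/-- **E-an-8 (ii) `MinusOneTwistRigidity` (landed p551258) PROVED from print** (same input). -/
theorem minusOneTwistRigidity_of_pal (h : NegOneTwistMinimalDiscrEq) : MinusOneTwistRigidity :=
  minusOneTwistRigidity_of_discrEq (negOneTwistSameLevelDiscrEq_of_minimalDiscrEq h (by norm_num))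

/-- **THEOREM I at `2⁴` (sharper than the landed `2⁵` form), from print:** on every same-level
`χ₋₄`-orbit with `16 ∣ N`, lattice-optimal data satisfy `W ⊗ χ₋₄ ≅ W′`, `c′ = ±c`, `deg′ = deg`. -/
theorem negOne_optimal_orbit_sixteen_of_pal (h : NegOneTwistMinimalDiscrEq) :
    ∀ (W W' : WeierstrassCurve ℚ) [W.IsElliptic] [W.IsGloballyMinimal] [W'.IsElliptic]
    [W'.IsGloballyMinimal] [NeZero (W.conductorNorm ℤ)] [NeZero (W'.conductorNorm ℤ)]
    (D : ModularParametrizationData W (W.conductorNorm ℤ))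
    (D' : ModularParametrizationData W' (W'.conductorNorm ℤ)),
    IsLatticeOptimal D → IsLatticeOptimal D' →
    16 ∣ W.conductorNorm ℤ → W'.conductorNorm ℤ = W.conductorNorm ℤ →
    IsIsogenous (W.quadraticTwist ((-1 : ℤ) : ℚ)) W' →
    (∃ u : VariableChange ℚ, u • W.quadraticTwist ((-1 : ℤ) : ℚ) = W') ∧
      (D'.c = D.c ∨ D'.c = -D.c) ∧ D'.modularDegree = D.modularDegree := by
  intro W W' _ _ _ _ _ _ D D' hD hD' h16 hN hiso
  obtain ⟨u, hu⟩ := negOneOptimalTwistRigidity_sixteen W W' D D' hD hD' h16 hN hiso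
  have hΔ : W'.Δ = W.Δ :=
    negOneTwistSameLevelDiscrEq_of_minimalDiscrEq h (by norm_num : 4 ∣ 16) W W' u h16 hN hu
  have key := negOneCommutingOrbitManinDegEq_holds dvd_rfl W W' u D D' h16 hN hu hD hD' hΔ
  exact ⟨⟨u, hu⟩, key.1, key.2⟩

end OptimalRigidity

end Summit.BirchSwinnertonDyer.Rank1Residual.ManinAdditive
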